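import Summits.BirchSwinnertonDyer.Rank1Residual.X5.TwoAdicAdditiveL2Cyc
import Summits.BirchSwinnertonDyer.Rank1Residual.AdditivePotMult.ModelFreeClassTheorems
import HarnessLib

/-!
# ROUTE-L2 (lens «around», ADDITIVE 2), GEN 4: the `K`-road's descent (II-K) on the CANONICAL model —
# no globally minimal `K`-model, no class-group condition

Cell `bsd-2adic` (run/shared/lean/pub/bsd-2adic/, HUMAN RULING D-0036), seat `bsd-2adic-addL2` (GEN 4),
memo `HOME/bsd-2adic-addL2-MEMO-4.md`; sibling of `X5/TwoAdicAdditiveL2Cyc.lean` (MEMO-2, p401880).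
HONEST FRAMING: ONE displayed input (`def … : Prop`, parameters, NOTHING asserted) and two bookkeeping
theorems. MEMO-2 typed the descent over `K` (II-K*) `AddTwoL2Cyc.CycDescentOverKAtTwo W K W' c L ϖ` with
output `AdditivePotMult.MissingPPartOverAt W' 2` on a GLOBALLY MINIMAL `K`-model `W'` of `E_K` — which
exists only when the Weierstrass class of `E_K` in `Cl(K)` is trivial (always for the inertial fields
`K* ∈ {ℚ(i), ℚ(√±2)}`, not for a general Hoffstein–Luo field). The cell's model-free currency
(`AdditivePotMult/ModelFree.lean`: `MissingPPartOverCAt V p` with Dokchitser–Dokchitser's `C(E/K)`,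
descent `bsdp_of_pPartOverC_baseChange` on `V = W.baseChange K` from Milne 1972 any-model) removes the
condition. Here: (II-K)^C = the same descent statement with BOTH the main conjecture (I-K) and the output
read on the canonical model `W.baseChange K`; the composed door `bsdp_two_of_cycRoadC`; and the remark
that (I-K) ∧ (II-K)^C at analytic rank `0` over `K` IS the layer-1 over-`K` input of the route-K4 split of
crux `AdditiveRankZeroAtTwo` (`Theorems/ByReductionTypeAtTwoAdditiveInputs.lean`, p421450), so that the
`K`-road glues INTO that child (modularity only), not merely into the parent.
-/

noncomputable section

open scoped Classical

open WeierstrassCurve Literature.NumberTheory.EllipticCurves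
  Literature.NumberTheory.EllipticCurves.Rank1Residual
  Literature.NumberTheory.EllipticCurves.Rank1Residual.Typed
  Summit.BirchSwinnertonDyer.Rank1Residual.AdditivePotMult
  Summit.BirchSwinnertonDyer.Rank1Residual.X5.AddTwoL2

namespace Summit.BirchSwinnertonDyer.Rank1Residual.X5.AddTwoL2Cyc

/-- **TYPED INPUT (II-K)^C — descent over `K` at analytic rank `0`, CANONICAL-model currency.** For `W/ℚ`
(the additive curve), `K` quadratic, a variable normalisation `c`, a generator `L` and a period index `ϖ`:
the `Λ_K`-main conjecture (I-K) for the canonical model `W.baseChange K` with generator `ϖ·L` implies,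
when `ord_{s=1} L(W/K,s) = 0`, the `2`-part of BSD for `E_K` in Dokchitser–Dokchitser's any-model
currency `AdditivePotMult.MissingPPartOverCAt (W.baseChange K) 2` (`#Ш_an` with `C(E/K, ω)` and
`Ω(E/K, ω)` for the differential `ω` of the model — the BSD quotient is model-invariant). CONTENT: the
same as MEMO-2's `CycDescentOverKAtTwo` (Greenberg 1999 Thm. 4.1 over `F = K` at the semistable ramified
prime above `2` + MTT interpolation on both branches + the twist-period identity), read on the canonical
model: no globally minimal `K`-model, no class-group condition. A predicate; nothing asserted.
[cite: GreenbergLNM1716, Thm. 4.1 (general F; shape only)]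
[cite: DokchitserDokchitserAnnals2010, §1 Notation and §2.1 (the any-model BSD quotient)] -/
def CycDescentOverKCAtTwo (W : WeierstrassCurve ℚ) [W.IsElliptic] (K : Type) [Field K] [NumberField K]
    (c : ℤ_[2]) (L : PowerSeries ℚ_[2]) (ϖ : ℚ) : Prop :=
  CycMainConjectureOverKAtTwo (W.baseChange K) c L ϖ → analyticRankEK W K = 0 →
    MissingPPartOverCAt (W.baseChange K) 2

section Door

variable (W : WeierstrassCurve ℚ) [W.IsElliptic] (K : Type) [Field K] [NumberField K]

/-- **(I-K) ∧ (II-K)^C at analytic rank `0` over `K` give the over-`K` input on the canonical model** —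
the layer-1 child `AddQuadraticOverKAtTwo` of crux `AdditiveRankZeroAtTwo` per pair `(W, K)`; and for
`W` of analytic rank `0` with `L(W^{(d_K)},1) ≠ 0` the rank hypothesis follows from modularity
(`analyticRankEK W K = r_an(W) + r_an(W^{(d_K)})`). Bookkeeping. [folklore] -/
theorem missingPPartOverCAt_of_cycRoadC (hmod : hasEntireLFunction_rat) (hr : W.analyticRank = 0)
    (hL : (W.quadraticTwist (NumberField.discr K : ℚ)).entireLFunction 1 ≠ 0)
    {c : ℤ_[2]} {L : PowerSeries ℚ_[2]} {ϖ : ℚ}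
    (hIMC : CycMainConjectureOverKAtTwo (W.baseChange K) c L ϖ) (hdesc : CycDescentOverKCAtTwo W K c L ϖ) :
    MissingPPartOverCAt (W.baseChange K) 2 := by
  have hr0 : analyticRankEK W K = 0 := by
    rw [analyticRankEK_eq_add_of hmod W K, hr, analyticRank_eq_zero_of_entireLFunction_one_ne_zero hL]
  exact hdesc hIMC hr0

/-- **Door L2-K, canonical-model form (BSD₂ form).** For `W/ℚ` globally minimal of analytic rank `0`, `K`
quadratic, `Wd` a globally minimal model of the twist `W^{(d_K)}` with `L(W^{(d_K)},1) ≠ 0` and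
`BSD(Wd,2)` (the route's sibling cruxes, or a proved class): (I-K) on `W.baseChange K` ∧ (II-K)^C ⟹
`BSD(W,2)` — through `missingPPartOverCAt_of_cycRoadC` and the model-free Milne descent
`AdditivePotMult.bsdp_of_pPartOverC_baseChange` (GZK, modularity, Milne 1972 any-model). No globally
minimal `K`-model is chosen. [cite: Milne1972ArithmeticAV, §1 Thm. 1 (through DokchitserDokchitserAnnals2010 §2.1)] -/
theorem bsdp_two_of_cycRoadC [W.IsGloballyMinimal] (Wd : WeierstrassCurve ℚ) [Wd.IsElliptic]
    [Wd.IsGloballyMinimal]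
    (hGZK : rank_eq_analyticRank_of_analyticRank_le_one) (hmod : hasEntireLFunction_rat)
    (hMilneC : Milne1972.bsdQuotient_baseChange_quadratic_anyModel)
    (hr : W.analyticRank = 0) (h2 : Module.finrank ℚ K = 2)
    (hWd : ∃ C : VariableChange ℚ, C • W.quadraticTwist (NumberField.discr K : ℚ) = Wd)
    (hL : (W.quadraticTwist (NumberField.discr K : ℚ)).entireLFunction 1 ≠ 0)
    {c : ℤ_[2]} {L : PowerSeries ℚ_[2]} {ϖ : ℚ}
    (hIMC : CycMainConjectureOverKAtTwo (W.baseChange K) c L ϖ) (hdesc : CycDescentOverKCAtTwo W K c L ϖ)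
    (hd : BSDp Wd 2) : BSDp W 2 := by
  haveI : Fact (Nat.Prime 2) := ⟨Nat.prime_two⟩
  have hdK : (NumberField.discr K : ℚ) ≠ 0 := by exact_mod_cast NumberField.discr_ne_zero K
  haveI := W.isElliptic_quadraticTwist hdK
  have hrd : Wd.analyticRank = 0 := by
    obtain ⟨C, rfl⟩ := hWd
    rw [analyticRank_smul]
    exact analyticRank_eq_zero_of_entireLFunction_one_ne_zero hL
  exact bsdp_of_pPartOverC_baseChange W 2 K Wd hGZK hmod hMilneC (by omega) h2 hWd (by omega)
    (missingPPartOverCAt_of_cycRoadC W K hmod hr hL hIMC hdesc) hd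

end Door

end Summit.BirchSwinnertonDyer.Rank1Residual.X5.AddTwoL2Cyc

end
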